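import Summits.Langlands.Langlands.Theorems.CoreAdequacySplitNoAdequateLayerLiftingStubCoprimeTableLiftingBridgeConverse
import Summits.Langlands.Langlands.Theorems.ExtendedAdequacySplit
import Literature.RepresentationTheory.FiniteGroups.WeakAdequacyLowDegree

/-!
# RSL `CoreAdequacySplit.NoAdequateLayerLifting` (stmt-Langlands-27954), line `birth`, stub 3/3 `stub_coprimeTableLifting` — STRUCTURAL HELPERS, part 7:
# on the rows `n < ℓ` quasi-adequacy of a layer is just `Hom(J, 𝔽̄_ℓ) = 0`; hence the HIGH rows (n < ℓ, no quasi-adequate layer) are CORE-REDUCIBLE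

Granted the landed named fact `GuralnickHerzigTiep2015_thm_1_2_of_lt` (GHT 2015 Thm. 1.2, `dim V < p`: weak adequacy is automatic), on the rows
`n < ℓ` of the residual table the three non-cohomological clauses of Thorne-adequacy collapse: for a finite absolutely irreducible `J ≤ GL_n(𝔽̄_ℓ)`,
(ii) `(ad⁰)^J = 0` and (iv) eigen-spanning follow from the span clause (`n ≠ 0` in `𝔽̄_ℓ`, `𝔽̄_ℓ` algebraically closed), so
`LieDefect.IsQuasiAdequate J ⟺ Hom(J, 𝔽̄_ℓ) = 0` (`isQuasiAdequate_iff_hom_of_lt`).  Consequences: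
* the PERFECT CORE `P` of the image, when absolutely irreducible, is a quasi-adequate layer (`Hom(P, k) = 0` for perfect `P`):
  `quasiAdequateBetween_of_coreAbsIrreducible_of_lt`; so on the rows `n < ℓ`, ¬SQAL ⟹ ¬CoreIrr: every instance of the HIGH cell
  `ExtAdequacy.GenericPrimeDegenerateLifting` (DEG ∧ n < ℓ) of route ExtendedAdequacySplit has a CORE-REDUCIBLE image and no extended-adequate layer
  (`high_row_profile`) — i.e. HIGH sits in the hypotheses of the bridge cell CRD except for its position literal `ℓ ≤ n`: it is a transport
  (T_N-type) cell, not a residual;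
* on the TABLE rows `n < ℓ`: an instance is DEG (no quasi-adequate layer) iff every absolutely irreducible layer `J` above the perfect core has an
  `ℓ`-quotient (`Hom(J, 𝔽̄_ℓ) ≠ 0`), and LIE otherwise with the obstruction `H¹(J, ad⁰) ≠ 0` at a layer with `Hom(J, 𝔽̄_ℓ) = 0` (part 6).
Conditional on the named fact only; no new definition; 0 sorry.
-/

set_option linter.dupNamespace false

namespace Summit.Langlands.Langlands.Theorems.CoreAdequacy.CoprimeTable

open scoped MatrixGroups
open Literature.NumberTheory.GaloisRepresentations
open Summit.Langlands.Langlands.Theses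
open Literature.RepresentationTheory.FiniteGroups (GuralnickHerzigTiep2015_thm_1_2_of_lt)

universe u

section Group

variable {k : Type u} [Field k] {n : ℕ}

/-- **Clause (ii) from the span clause**: if the semisimple elements of `H` span `M_n(k)` and `n ≠ 0` in `k`, then `(ad⁰)^H = 0` (an invariant
trace-zero matrix commutes with all of `M_n(k)`, hence is scalar of trace zero). -/
theorem adZeroRep_invariants_eq_bot_of_semisimpleSpan_eq_top (hn : (n : k) ≠ 0) {H : Subgroup (GL (Fin n) k)} (hspan : Subgroup.semisimpleSpan H = ⊤) :
    (Subgroup.adZeroRep H).invariants = ⊥ := by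
  refine (Submodule.eq_bot_iff _).2 fun M hM => ?_
  have hfix := (Representation.mem_invariants _ M).1 hM
  have hscal : (M : Matrix (Fin n) (Fin n) k) ∈ scalarMatrices (Fin n) k := by
    refine mem_scalarMatrices_of_forall_commute hspan fun h _ => ?_
    have e := congrArg Subtype.val (hfix h)
    rw [Subgroup.coe_adZeroRep_apply] at e
    have e' := congrArg (· * (((h : GL (Fin n) k)) : Matrix (Fin n) (Fin n) k)) e
    simp only [Matrix.mul_assoc, Units.inv_mul, Matrix.mul_one] at e'
    exact e'
  exact Subtype.ext (eq_zero_of_mem_scalarMatrices_of_trace_eq_zero hn hscal ((mem_adZero_toSubmodule_iff _).1 M.2))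

/-- **Clause (iv) from the span clause** over an algebraically closed field: for a simple `k[H]`-submodule `W ⊆ ad⁰` some semisimple `h ∈ H` and
`α` have `tr(e_{h,α} w) ≠ 0` for some `w ∈ W` (non-degeneracy of the trace form + spectral decomposition of `h`; the tree's argument for `ad`
verbatim on `ad⁰`). -/
theorem adZeroRep_exists_trace_eigenprojection_ne_zero_of_semisimpleSpan_eq_top [IsAlgClosed k] {H : Subgroup (GL (Fin n) k)}
    (hspan : Subgroup.semisimpleSpan H = ⊤) (W : Subrepresentation (Subgroup.adZeroRep H)) (hW : IsAtom W) :
    ∃ h : H, (orderOf (h : GL (Fin n) k)).Coprime (ringChar k) ∧ ∃ α : k, ∃ w ∈ W,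
      (eigenprojectionMatrix (((h : GL (Fin n) k)) : Matrix (Fin n) (Fin n) k) α * (w : Matrix (Fin n) (Fin n) k)).trace ≠ 0 := by
  classical
  obtain ⟨w, hw, hw0⟩ := Subrepresentation.exists_mem_ne_zero W hW.1
  have hw0' : (w : Matrix (Fin n) (Fin n) k) ≠ 0 := fun h0 => hw0 (Subtype.ext h0)
  have hex : ∃ h : H, (orderOf (h : GL (Fin n) k)).Coprime (ringChar k) ∧
      ((((h : GL (Fin n) k)) : Matrix (Fin n) (Fin n) k) * (w : Matrix (Fin n) (Fin n) k)).trace ≠ 0 := by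
    by_contra hcon
    push Not at hcon
    have hall : ∀ m : Matrix (Fin n) (Fin n) k, (m * (w : Matrix (Fin n) (Fin n) k)).trace = 0 := by
      intro m
      have hm : m ∈ Subgroup.semisimpleSpan H := hspan ▸ Submodule.mem_top
      rw [Subgroup.semisimpleSpan] at hm
      refine Submodule.span_induction (p := fun m _ => (m * (w : Matrix (Fin n) (Fin n) k)).trace = 0) ?_ ?_ ?_ ?_ hm
      · rintro _ ⟨h, hh, rfl⟩
        exact hcon h hh
      · rw [Matrix.zero_mul, Matrix.trace_zero]
      · intro x y _ _ hx hy
        rw [Matrix.add_mul, Matrix.trace_add, hx, hy, add_zero]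
      · intro c x _ hx
        rw [Matrix.smul_mul, Matrix.trace_smul, hx, smul_zero]
    apply hw0'
    ext i j
    have hij := hall (Matrix.single j i 1)
    rwa [Matrix.trace_single_mul, one_smul] at hij
  obtain ⟨h, hh, htr⟩ := hex
  obtain ⟨S, hS⟩ := exists_trace_mul_eq_sum _ (iSup_eigenspace_eq_top_of_coprime_orderOf (h : GL (Fin n) k) hh)
  rw [hS] at htr
  obtain ⟨μ, -, hμ⟩ := Finset.exists_ne_zero_of_sum_ne_zero htr
  exact ⟨h, hh, μ, w, hw, fun h0 => hμ (by rw [h0, mul_zero])⟩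

/-- **Weakly adequate ⟹ (quasi-adequate ⟺ no additive characters)** (`k` algebraically closed, `n ≠ 0` in `k`). -/
theorem isQuasiAdequate_iff_hom_of_semisimpleSpan_eq_top [IsAlgClosed k] (hn : (n : k) ≠ 0) {H : Subgroup (GL (Fin n) k)}
    (hspan : Subgroup.semisimpleSpan H = ⊤) : LieDefect.IsQuasiAdequate H ↔ ∀ f : Additive H →+ k, f = 0 :=
  ⟨fun h => h.1, fun h1 => ⟨h1, adZeroRep_invariants_eq_bot_of_semisimpleSpan_eq_top hn hspan,
    adZeroRep_exists_trace_eigenprojection_ne_zero_of_semisimpleSpan_eq_top hspan⟩⟩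

end Group

section LowRows

variable {ℓ : ℕ} [Fact ℓ.Prime] {n : ℕ}

/-- **Rows `n < ℓ`: a finite absolutely irreducible `J ≤ GL_n(𝔽̄_ℓ)` is quasi-adequate iff `Hom(J, 𝔽̄_ℓ) = 0`** (GHT 2015 Thm. 1.2 granted). -/
theorem isQuasiAdequate_iff_hom_of_lt (hGHT : GuralnickHerzigTiep2015_thm_1_2_of_lt) (hnℓ : n < ℓ) (hn : 0 < n)
    (J : Subgroup (GL (Fin n) (padicAlgClResidueField ℓ))) [Finite J] (hJ : IsAbsIrreducible J.subtype) :
    LieDefect.IsQuasiAdequate J ↔ ∀ f : Additive J →+ padicAlgClResidueField ℓ, f = 0 := by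
  haveI : IsAlgClosed (padicAlgClResidueField ℓ) := Literature.RingTheory.Valuation.isAlgClosed_residueField (padicAlgClIntegers ℓ)
  haveI := charP_padicAlgClResidueField ℓ
  have hℓn : ¬ ℓ ∣ n := fun h => absurd (Nat.le_of_dvd hn h) (not_le.2 hnℓ)
  exact isQuasiAdequate_iff_hom_of_semisimpleSpan_eq_top (natCast_ne_zero_of_not_dvd hℓn)
    (hGHT (padicAlgClResidueField ℓ) ℓ n J inferInstance hJ hnℓ)

/-- **Rows `n < ℓ`: an absolutely irreducible PERFECT CORE is a quasi-adequate layer** (`Hom(P, k) = 0` for perfect `P`): CoreIrr ⟹ SQAL at the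
group level (GHT 2015 Thm. 1.2 granted). -/
theorem quasiAdequateBetween_of_coreAbsIrreducible_of_lt (hGHT : GuralnickHerzigTiep2015_thm_1_2_of_lt) (hnℓ : n < ℓ)
    (I : Subgroup (GL (Fin n) (padicAlgClResidueField ℓ))) [Finite I] (hP : IsAbsIrreducible (perfectCore I).subtype) :
    LieDefect.QuasiAdequateBetween I := by
  haveI : Finite (perfectCore I) := Finite.of_injective _ (Subgroup.inclusion_injective (isPerfectCore_perfectCore I).1)
  refine ⟨perfectCore I, LieDefect.aboveCore_iff_perfectCore_le.2 le_rfl, (isPerfectCore_perfectCore I).1, hP, ?_⟩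
  exact (isQuasiAdequate_iff_hom_of_lt hGHT hnℓ hP.pos (perfectCore I) hP).2
    fun f => addMonoidHom_eq_zero_of_perfect (perfectCore I) (isPerfectCore_perfectCore I).2.1 f

variable {K : Type} [Field K] [NumberField K]

/-- **Rows `n < ℓ`: ¬SQAL ⟹ ¬CoreIrr** — an instance with no quasi-adequate layer has a CORE-REDUCIBLE image (GHT 2015 Thm. 1.2 granted). -/
theorem not_coreIrreducibleImage_of_lt (hGHT : GuralnickHerzigTiep2015_thm_1_2_of_lt) (hnℓ : n < ℓ) {ρ : FramedGaloisRep K (PadicAlgCl ℓ) n}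
    (hQ : ¬ LieDefect.SolvablyQuasiAdequateImage ρ) : ¬ ExtAdequacy.CoreIrreducibleImage ρ := by
  rintro ⟨τ, hτ, hirr, hP⟩
  haveI : Finite τ.range := finite_range_of_isReductionOf hτ
  exact hQ ((LieDefect.solvablyQuasiAdequateImage_iff ρ).2 ⟨τ, hτ, hirr, quasiAdequateBetween_of_coreAbsIrreducible_of_lt hGHT hnℓ τ.range hP⟩)

/-- **HIGH-ROW PROFILE** (the cell `ExtAdequacy.GenericPrimeDegenerateLifting`: DEG ∧ `n < ℓ`): its instances have `ℓ ∤ n`, NO extended-adequate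
layer (¬SXADQ, bridge of parts 2/4) and a CORE-REDUCIBLE image (¬CoreIrr, GHT 2015 Thm. 1.2 granted) — exactly the image hypotheses of the bridge
cell CRD (`CoreReducibleDegenerateLifting`) with the position literal `ℓ ≤ n` replaced by `n < ℓ`: HIGH is a transport-type cell. -/
theorem high_row_profile (hGHT : GuralnickHerzigTiep2015_thm_1_2_of_lt) (hnℓ : n < ℓ) (hn : 0 < n) {ρ : FramedGaloisRep K (PadicAlgCl ℓ) n}
    (hN : ¬ SolvablyAdequateImage ρ) (hQ : ¬ LieDefect.SolvablyQuasiAdequateImage ρ) :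
    ¬ ℓ ∣ n ∧ ¬ ExtAdequacy.SolvablyExtAdequateImage ρ ∧ ¬ ExtAdequacy.CoreIrreducibleImage ρ := by
  have hℓn : ¬ ℓ ∣ n := fun h => absurd (Nat.le_of_dvd hn h) (not_le.2 hnℓ)
  exact ⟨hℓn, not_solvablyExtAdequateImage_of_coprime_row hℓn hN, not_coreIrreducibleImage_of_lt hGHT hnℓ hQ⟩

end LowRows

end Summit.Langlands.Langlands.Theorems.CoreAdequacy.CoprimeTable
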